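import Literature.AlgebraicTopology.FundamentalGroup.TwicePuncturedChartSegment
import Literature.AlgebraicTopology.FundamentalGroup.FreeProductIntRank
import Mathlib.Topology.LocallyConstant.Basic
import Mathlib.Geometry.Manifold.ChartedSpace
import HarnessLib

/-!
# Puncture independence: freeness of `π₁(M ∖ S)` does not depend on the finite set `S ≠ ∅`

Topic `Literature/AlgebraicTopology/FundamentalGroup`.  For a connected Hausdorff surface `M` (a
`ChartedSpace ℂ M`; no smooth or complex structure is used) and finite non-empty sets `S, S' ⊆ M`:

> `π₁(M ∖ S)` is free of finite rank (at every base point) **iff** `π₁(M ∖ S')` is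
> (`PunctureIndependence.freePi_iff_freePi`, base-point form
> `PunctureIndependence.isFreeOfFiniteRank_fundamentalGroup_compl_of_compl`).

This is the form in which the classical computation «a compact orientable surface of genus `g` minus
`r ≥ 1` points has free fundamental group of rank `2g + r - 1`» (W. S. Massey, *Algebraic Topology: An
Introduction* (1967), Ch. 4 §5; A. Hatcher, *Algebraic Topology* (2002), §1.2 Example 1.22) propagates
from ONE puncture set to all of them; it is used by the sequel
`PuncturedCompactRiemannSurfaceFreePi1Holds` to discharge the named fact
`PuncturedCompactRiemannSurfaceFreePi1` from a single finite puncture set obtained from a branched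
cover of the sphere.

PROOF.  The local step is the tree's `ChartSegment.nonempty_mulEquiv_coprod_int` (two punctures in one
chart add a free factor `ℤ`, van Kampen) together with `isFreeOfFiniteRank_coprod_int_iff` (`G ∗ ℤ` is
free of finite rank iff `G` is): for `q` in a small chart ball about `p`,
`FreePi (S ∪ {p, q}) ↔ FreePi (S ∪ {p})` and symmetrically `↔ FreePi (S ∪ {q})`, so
`p ↦ FreePi (S ∪ {p})` is locally constant on the connected `M ∖ S`, hence constant; adding one puncture
at a time then gives `FreePi S ↔ FreePi (S ∪ T)`.  The connectivity inputs (§1–§2): removing a closed set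
with a good neighbourhood from a preconnected set keeps it preconnected (`isPreconnected_diff_of_nhd`,
the argument of Farkas–Kra IV.3.4 for the complement of a closed disc), whence complements of finite
sets and of «finite set ∪ chart segment» in `M` are path connected.

Main statements: `isPreconnected_diff_of_nhd`, `isPathConnected_compl_finite`,
`isPathConnected_compl_union_chartSegment`, `FreePi`, `freePi_insert_insert_iff`,
`freePi_insert_iff_insert`, `freePi_iff_insert`, `freePi_iff_union`, **`freePi_iff_freePi`**,
**`isFreeOfFiniteRank_fundamentalGroup_compl_of_compl`**.  Everything is proved; one definition (the
predicate `FreePi`), no instances, no named facts.  Classical; written for the abc-iut cell's geometric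
column of [AbsTopIII] Prop. 4.2 (i) / Cor. 4.5 (input (α)); nothing here bears on [IUTchIII] Cor. 3.12.

## References
* A. Hatcher, *Algebraic Topology*, CUP (2002), §1.2 Thm. 1.20, Example 1.22. [HatcherAT2002]
* H. M. Farkas, I. Kra, *Riemann Surfaces*, GTM 71, 2nd ed. (1992), IV.3.4, IV.3.7 (connectivity of
  complements of discs and points on a surface). [FarkasKra1992]
* W. S. Massey, *Algebraic Topology: An Introduction*, GTM 56 (1967/1977), Ch. 4 §5.
  [Massey1967AlgebraicTopology]
-/

noncomputable section

open Set Function Metric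
open scoped Topology

namespace Literature.AlgebraicTopology.FundamentalGroup

namespace PunctureIndependence

open Literature.IUT.HodgeTheaters (IsFreeOfFiniteRank)

/-! ### §1 A closed set with a good neighbourhood can be removed from a preconnected set -/

section Topology

variable {X : Type*} [TopologicalSpace X]

/-- **Removing a closed set inside a good neighbourhood preserves preconnectedness**: if `O` is
preconnected, `K ⊆ N ⊆ O` with `K` closed, `N` open and `N ∖ K` preconnected, then `O ∖ K` is
preconnected (if `O ∖ K = u ⊔ v`, the piece `N ∖ K` lies in one side, say `u`; then `u ∪ N` and
`v ∖ K` would disconnect `O`). [cite: FarkasKra1992, IV.3.4 (method)] -/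
theorem isPreconnected_diff_of_nhd {O K N : Set X} (hO : IsPreconnected O) (hKN : K ⊆ N)
    (hNO : N ⊆ O) (hK : IsClosed K) (hN : IsOpen N) (hA : IsPreconnected (N \ K)) :
    IsPreconnected (O \ K) := by
  intro u v hu hv hOuv hOu hOv
  by_contra hempty
  rw [Set.not_nonempty_iff_eq_empty] at hempty
  have hAO : N \ K ⊆ O \ K := fun x hx => ⟨hNO hx.1, hx.2⟩
  have hAuv : N \ K ⊆ u ∪ v := hAO.trans hOuv
  have hAe : (N \ K) ∩ (u ∩ v) = ∅ :=
    Set.eq_empty_of_subset_empty (hempty ▸ Set.inter_subset_inter_left _ hAO)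
  -- the key claim, symmetric in `u`, `v`
  have key : ∀ u v : Set X, IsOpen u → IsOpen v → O \ K ⊆ u ∪ v → (O \ K ∩ u).Nonempty →
      (O \ K ∩ v).Nonempty → (O \ K) ∩ (u ∩ v) = ∅ → N \ K ⊆ u → False := by
    intro u v hu hv hOuv hOu hOv hempty hAu
    have h1 : IsOpen (u ∪ N) := hu.union hN
    have h2 : IsOpen (v \ K) := hv.sdiff hK
    have hcov : O ⊆ (u ∪ N) ∪ (v \ K) := by
      intro x hx
      by_cases hxK : x ∈ K
      · exact Or.inl (Or.inr (hKN hxK))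
      · rcases hOuv ⟨hx, hxK⟩ with h | h
        · exact Or.inl (Or.inl h)
        · exact Or.inr ⟨h, hxK⟩
    obtain ⟨y, hyO, hyv⟩ := hOv
    obtain ⟨y', hy'O, hy'u⟩ := hOu
    obtain ⟨z, hzO, hz1, hz2⟩ := hO _ _ h1 h2 hcov ⟨y', hy'O.1, Or.inl hy'u⟩ ⟨y, hyO.1, hyv, hyO.2⟩
    have hzK : z ∉ K := hz2.2
    have hzu : z ∈ u := by
      rcases hz1 with h | h
      · exact h
      · exact hAu ⟨h, hzK⟩
    have : z ∈ (O \ K) ∩ (u ∩ v) := ⟨⟨hzO, hzK⟩, hzu, hz2.1⟩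
    rw [hempty] at this
    exact this
  by_cases hAu : N \ K ⊆ u
  · exact key u v hu hv hOuv hOu hOv hempty hAu
  · have hAv : N \ K ⊆ v := by
      intro z hz
      rcases hAuv hz with hzu | hzv
      · exfalso; apply hAu; intro w hw
        rcases hAuv hw with hwu | hwv
        · exact hwu
        · have := hA u v hu hv hAuv ⟨z, hz, hzu⟩ ⟨w, hw, hwv⟩
          rw [hAe] at this; exact absurd this Set.not_nonempty_empty
      · exact hzv
    exact key v u hv hu (fun x hx => (hOuv hx).symm) hOv hOu
      (by rw [← hempty]; ext x; simp only [mem_inter_iff]; tauto) hAv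

end Topology

/-! ### §2 Surfaces: complements of finite sets and of chart segments are path connected -/

section Surface

variable {M : Type*} [TopologicalSpace M] [ChartedSpace ℂ M]

/-- A chart ball about `p` avoiding a finite set `S ∌ p`. [cite: FarkasKra1992, IV.3.7 (method)] -/
theorem exists_chartBall_disjoint [T2Space M] {S : Set M} (hS : S.Finite) {p : M} (hp : p ∉ S) :
    ∃ R : ℝ, 0 < R ∧ ball (chartAt ℂ p p) R ⊆ (chartAt ℂ p).target ∧
      Disjoint S ((chartAt ℂ p).source ∩ chartAt ℂ p ⁻¹' ball (chartAt ℂ p p) R) := by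
  set e := chartAt ℂ p
  have hO : IsOpen (e.target ∩ e.symm ⁻¹' Sᶜ) :=
    e.isOpen_inter_preimage_symm hS.isClosed.isOpen_compl
  have hpO : e p ∈ e.target ∩ e.symm ⁻¹' Sᶜ :=
    ⟨e.map_source (mem_chart_source ℂ p), by
      show e.symm (e p) ∈ Sᶜ; rw [e.left_inv (mem_chart_source ℂ p)]; exact hp⟩
  obtain ⟨R, hR, hball⟩ := Metric.isOpen_iff.1 hO (e p) hpO
  refine ⟨R, hR, fun z hz => (hball hz).1, Set.disjoint_left.2 fun y hyS hy => ?_⟩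
  have := (hball hy.2).2
  rw [mem_preimage, e.left_inv hy.1] at this
  exact this hyS

/-- A point of the chart ball other than its centre. [cite: FarkasKra1992, IV.3.7 (method)] -/
theorem exists_ne_mem_chartBall {p : M} {R : ℝ} (hR : 0 < R)
    (hRt : ball (chartAt ℂ p p) R ⊆ (chartAt ℂ p).target) :
    ∃ q : M, q ≠ p ∧ q ∈ (chartAt ℂ p).source ∧ chartAt ℂ p q ∈ ball (chartAt ℂ p p) R := by
  set e := chartAt ℂ p
  have hz : e p + ((R / 2 : ℝ) : ℂ) ∈ ball (e p) R := by
    rw [mem_ball, dist_eq_norm, add_sub_cancel_left, Complex.norm_real, Real.norm_eq_abs,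
      abs_of_pos (by positivity)]
    linarith
  refine ⟨e.symm (e p + ((R / 2 : ℝ) : ℂ)), fun h => ?_, e.map_target (hRt hz),
    by rw [e.right_inv (hRt hz)]; exact hz⟩
  have := congrArg e h
  rw [e.right_inv (hRt hz)] at this
  have h2 : ((R / 2 : ℝ) : ℂ) = 0 := by simpa using this
  rw [Complex.ofReal_eq_zero] at h2
  linarith

/-- The punctured chart ball is path connected. [cite: FarkasKra1992, IV.3.7 (method)] -/
theorem isPathConnected_chartBall_diff_singleton {p : M} {R : ℝ} (hR : 0 < R)
    (hRt : ball (chartAt ℂ p p) R ⊆ (chartAt ℂ p).target) :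
    IsPathConnected (((chartAt ℂ p).source ∩ chartAt ℂ p ⁻¹' ball (chartAt ℂ p p) R) \ {p}) := by
  set e := chartAt ℂ p
  have hps : p ∈ e.source := mem_chart_source ℂ p
  have hplane : IsPathConnected (ball (e p) R \ {e p}) := by
    refine isPathConnected_convex_diff_finite (convex_ball _ _) isOpen_ball (Set.finite_singleton _)
      ⟨e p + ((R / 2 : ℝ) : ℂ), ?_, ?_⟩
    · rw [mem_ball, dist_eq_norm, add_sub_cancel_left, Complex.norm_real, Real.norm_eq_abs,
        abs_of_pos (by positivity)]; linarith
    · intro h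
      have h2 : ((R / 2 : ℝ) : ℂ) = 0 := by simpa using h
      rw [Complex.ofReal_eq_zero] at h2; linarith
  have himage : e.symm '' (ball (e p) R \ {e p}) = (e.source ∩ e ⁻¹' ball (e p) R) \ {p} := by
    ext y
    constructor
    · rintro ⟨z, ⟨hz, hzp⟩, rfl⟩
      refine ⟨⟨e.map_target (hRt hz), by rw [mem_preimage, e.right_inv (hRt hz)]; exact hz⟩,
        fun h => hzp ?_⟩
      have := congrArg e h
      rwa [e.right_inv (hRt hz)] at this
    · rintro ⟨⟨hys, hyE⟩, hyp⟩
      exact ⟨e y, ⟨hyE, fun h => hyp (e.injOn hys hps h)⟩, e.left_inv hys⟩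
  rw [← himage]
  exact hplane.image' (e.continuousOn_symm.mono fun z hz => hRt hz.1)

/-- `M` is locally path connected (charts). [cite: FarkasKra1992, IV.3.7 (method)] -/
theorem locallyPathConnectedSpace : LocallyPathConnectedSpace M :=
  ChartedSpace.locallyPathConnectedSpace ℂ M

/-- A connected open subset of `M` is path connected. [cite: FarkasKra1992, IV.3.7 (method)] -/
theorem isPathConnected_of_isPreconnected_of_isOpen {U : Set M} (hU : IsOpen U)
    (hc : IsPreconnected U) (hne : U.Nonempty) : IsPathConnected U := by
  haveI := locallyPathConnectedSpace (M := M)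
  exact hU.isConnected_iff_isPathConnected.1 ⟨hne, hc⟩

/-- **The complement of a finite set in a connected surface is preconnected** (remove the points one
at a time with `isPreconnected_diff_of_nhd` and a punctured chart ball). [cite: FarkasKra1992, IV.3.7] -/
theorem isPreconnected_compl_finite [T2Space M] [ConnectedSpace M] {S : Set M} (hS : S.Finite) :
    IsPreconnected Sᶜ := by
  induction S, hS using Set.Finite.induction_on with
  | empty => rw [compl_empty]; exact isPreconnected_univ
  | @insert p S₀ hp hS₀ ih =>
    obtain ⟨R, hR, hRt, hdisj⟩ := exists_chartBall_disjoint hS₀ hp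
    have hNO : (chartAt ℂ p).source ∩ chartAt ℂ p ⁻¹' ball (chartAt ℂ p p) R ⊆ S₀ᶜ :=
      fun y hy hyS => hdisj.le_bot ⟨hyS, hy⟩
    have hpN : p ∈ (chartAt ℂ p).source ∩ chartAt ℂ p ⁻¹' ball (chartAt ℂ p p) R :=
      ⟨mem_chart_source ℂ p, mem_ball_self hR⟩
    have key := isPreconnected_diff_of_nhd ih (K := {p}) (Set.singleton_subset_iff.2 hpN) hNO
      isClosed_singleton ((chartAt ℂ p).isOpen_inter_preimage isOpen_ball)
      (isPathConnected_chartBall_diff_singleton hR hRt).isConnected.isPreconnected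
    have hset : S₀ᶜ \ {p} = (insert p S₀)ᶜ := by
      ext x; simp only [Set.mem_sdiff, mem_compl_iff, mem_insert_iff, mem_singleton_iff, not_or]; tauto
    rwa [hset] at key

/-- **The complement of a finite set in a connected surface is path connected.**
[cite: FarkasKra1992, IV.3.7] -/
theorem isPathConnected_compl_finite [T2Space M] [ConnectedSpace M] {S : Set M} (hS : S.Finite)
    (hne : Sᶜ.Nonempty) : IsPathConnected Sᶜ :=
  isPathConnected_of_isPreconnected_of_isOpen hS.isClosed.isOpen_compl (isPreconnected_compl_finite hS) hne

/-- **The complement of a finite set together with a chart segment is path connected** (the chart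
ball minus the segment is path connected, `ChartSegment.isPathConnected_chartBall_diff_segment`;
remove it from `M ∖ S` with `isPreconnected_diff_of_nhd`). [cite: FarkasKra1992, IV.3.4 (method)] -/
theorem isPathConnected_compl_union_chartSegment [T2Space M] [ConnectedSpace M] {S : Set M}
    (hS : S.Finite) {p q : M} {R : ℝ}
    (hq : q ∈ (chartAt ℂ p).source) (hpq : p ≠ q)
    (hRt : ball (chartAt ℂ p p) R ⊆ (chartAt ℂ p).target) (hqR : chartAt ℂ p q ∈ ball (chartAt ℂ p p) R)
    (hdisj : Disjoint S ((chartAt ℂ p).source ∩ chartAt ℂ p ⁻¹' ball (chartAt ℂ p p) R)) :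
    IsPathConnected
      (S ∪ ((chartAt ℂ p).source ∩ chartAt ℂ p ⁻¹' segment ℝ (chartAt ℂ p p) (chartAt ℂ p q)))ᶜ := by
  set e := chartAt ℂ p
  have hps : p ∈ e.source := mem_chart_source ℂ p
  have hR : 0 < R := lt_of_le_of_lt dist_nonneg (mem_ball.1 hqR)
  set N : Set M := e.source ∩ e ⁻¹' ball (e p) R
  set K : Set M := e.source ∩ e ⁻¹' segment ℝ (e p) (e q)
  have hNO : N ⊆ Sᶜ := fun y hy hyS => hdisj.le_bot ⟨hyS, hy⟩
  have hSne : Sᶜ.Nonempty := ⟨p, hNO ⟨hps, mem_ball_self hR⟩⟩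
  have hKN : K ⊆ N := fun y hy =>
    ⟨hy.1, (convex_ball (e p) R).segment_subset (mem_ball_self hR) hqR hy.2⟩
  -- `K` is closed: compact image of the segment
  have hsub : segment ℝ (e p) (e q) ⊆ e.target :=
    ((convex_ball (e p) R).segment_subset (mem_ball_self hR) hqR).trans hRt
  have hKc : IsClosed K := by
    have : K = e.symm '' segment ℝ (e p) (e q) := (e.symm_image_eq_source_inter_preimage hsub).symm
    rw [this]
    have hc : IsCompact (segment ℝ (e p) (e q)) := by
      rw [segment_eq_image']; exact isCompact_Icc.image (by fun_prop)
    exact (hc.image_of_continuousOn (e.continuousOn_symm.mono hsub)).isClosed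
  have hpre := isPreconnected_diff_of_nhd (isPathConnected_compl_finite hS hSne).isConnected.isPreconnected
    hKN hNO hKc (e.isOpen_inter_preimage isOpen_ball)
    (ChartSegment.isPathConnected_chartBall_diff_segment hps hq hpq hRt hqR).isConnected.isPreconnected
  rw [Set.sdiff_eq, ← Set.compl_union] at hpre
  have hne : (S ∪ K)ᶜ.Nonempty := by
    obtain ⟨y, hy⟩ := (ChartSegment.isPathConnected_chartBall_diff_segment hps hq hpq hRt hqR).nonempty
    exact ⟨y, fun h => h.elim (fun hyS => hNO hy.1 hyS) (fun hyK => hy.2 hyK)⟩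
  exact isPathConnected_of_isPreconnected_of_isOpen (hS.isClosed.union hKc).isOpen_compl hpre hne

end Surface

/-! ### §3 Puncture independence -/

section Independence

variable {M : Type} [TopologicalSpace M] [T2Space M] [ConnectedSpace M] [ChartedSpace ℂ M]

/-- **`FreePi S`**: `π₁(M ∖ S, x)` is free of finite rank at every base point `x` (the property of a
punctured surface computed in Massey Ch. 4 §5 / Hatcher Example 1.22). [cite: HatcherAT2002, §1.2 Example 1.22] -/
def FreePi (S : Set M) : Prop :=
  ∀ x : ↥(Sᶜ : Set M), IsFreeOfFiniteRank (_root_.FundamentalGroup ↥(Sᶜ : Set M) x)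

omit [T2Space M] [ConnectedSpace M] [ChartedSpace ℂ M] in
/-- With a path connected complement, one base point suffices. [cite: HatcherAT2002, §1.2 Example 1.22 (method); Prop. 1.5] -/
theorem freePi_of_exists {S : Set M} (hS : IsPathConnected Sᶜ)
    (h : ∃ x : ↥(Sᶜ : Set M), IsFreeOfFiniteRank (_root_.FundamentalGroup ↥(Sᶜ : Set M) x)) :
    FreePi S := by
  obtain ⟨x, hx⟩ := h
  haveI : PathConnectedSpace ↥(Sᶜ : Set M) := isPathConnected_iff_pathConnectedSpace.1 hS
  intro y
  exact IsFreeOfFiniteRank.congr (_root_.FundamentalGroup.fundamentalGroupMulEquivOfPathConnected x y) hx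

/-- **The local step**: for `q ≠ p` in a chart ball about `p` avoiding the finite set `S`,
`FreePi (S ∪ {p, q}) ↔ FreePi (S ∪ {p})` (two punctures in one chart add a free factor `ℤ`,
`ChartSegment.nonempty_mulEquiv_coprod_int`, and `G ∗ ℤ` is free of finite rank iff `G` is,
`isFreeOfFiniteRank_coprod_int_iff`). [cite: HatcherAT2002, §1.2 Example 1.22] -/
theorem freePi_insert_insert_iff {S : Set M} (hS : S.Finite) {p q : M} {R : ℝ}
    (hq : q ∈ (chartAt ℂ p).source) (hpq : p ≠ q)
    (hRt : ball (chartAt ℂ p p) R ⊆ (chartAt ℂ p).target) (hqR : chartAt ℂ p q ∈ ball (chartAt ℂ p p) R)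
    (hdisj : Disjoint S ((chartAt ℂ p).source ∩ chartAt ℂ p ⁻¹' ball (chartAt ℂ p p) R)) :
    FreePi (insert p (insert q S)) ↔ FreePi (insert p S) := by
  have hps : p ∈ (chartAt ℂ p).source := mem_chart_source ℂ p
  have hU := isPathConnected_compl_union_chartSegment hS hq hpq hRt hqR hdisj
  have h2 := ChartSegment.isPathConnected_compl_insert_insert hps hq hpq hRt hqR hS.isClosed hdisj hU
  have h1 := ChartSegment.isPathConnected_compl_insert hps hq hpq hRt hqR hS.isClosed hdisj hU
  obtain ⟨x⟩ := h2.nonempty.to_subtype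
  obtain ⟨y⟩ := h1.nonempty.to_subtype
  obtain ⟨E⟩ := ChartSegment.nonempty_mulEquiv_coprod_int hps hq hpq hRt hqR hS.isClosed hdisj hU x y
  constructor
  · intro h
    exact freePi_of_exists h1 ⟨y, (isFreeOfFiniteRank_coprod_int_iff _).1 (IsFreeOfFiniteRank.congr E (h x))⟩
  · intro h
    exact freePi_of_exists h2 ⟨x, IsFreeOfFiniteRank.congr E.symm ((isFreeOfFiniteRank_coprod_int_iff _).2 (h y))⟩

/-- **Local constancy**: for `S` finite, `p ↦ FreePi (S ∪ {p})` is locally constant on `M ∖ S`.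
[cite: HatcherAT2002, §1.2 Example 1.22 (method)] -/
theorem freePi_insert_eventually_eq {S : Set M} (hS : S.Finite) {p : M} (hp : p ∉ S) :
    ∀ᶠ q in 𝓝 p, FreePi (insert q S) = FreePi (insert p S) := by
  obtain ⟨R, hR, hRt, hdisj⟩ := exists_chartBall_disjoint hS hp
  set e := chartAt ℂ p
  have hps : p ∈ e.source := mem_chart_source ℂ p
  have hV : e.source ∩ e ⁻¹' ball (e p) (R / 2) ∈ 𝓝 p :=
    (e.isOpen_inter_preimage isOpen_ball).mem_nhds ⟨hps, mem_ball_self (half_pos hR)⟩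
  filter_upwards [hV] with q hq
  by_cases hqp : q = p
  · rw [hqp]
  have hqs : q ∈ e.source := hq.1
  have hqR : e q ∈ ball (e p) R := ball_subset_ball (by linarith) hq.2
  -- first application: chart at `p`, pair `(p, q)`
  have A := freePi_insert_insert_iff hS hqs (Ne.symm hqp) hRt hqR hdisj
  -- second application: SAME chart, pair `(q, p)` with the ball of radius `R/2` about `e q`
  have hqS : q ∉ S := fun h => hdisj.le_bot ⟨h, hqs, hqR⟩
  have hball : ball (e q) (R / 2) ⊆ ball (e p) R := by
    intro z hz
    rw [mem_ball] at hz ⊢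
    have := mem_ball.1 hq.2
    calc dist z (e p) ≤ dist z (e q) + dist (e q) (e p) := dist_triangle _ _ _
      _ < R / 2 + R / 2 := add_lt_add hz this
      _ = R := by ring
  have hpR : e p ∈ ball (e q) (R / 2) := by rw [mem_ball, dist_comm]; exact mem_ball.1 hq.2
  have hsub : e.source ∩ e ⁻¹' ball (e q) (R / 2) ⊆ e.source ∩ e ⁻¹' ball (e p) R :=
    fun y hy => ⟨hy.1, hball hy.2⟩
  have hdisj' : Disjoint S (e.source ∩ e ⁻¹' ball (e q) (R / 2)) := hdisj.mono_right hsub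
  -- the chart at `p` serves as a chart about `q` (F2 is stated for an ARBITRARY chart)
  have hU : IsPathConnected (S ∪ (e.source ∩ e ⁻¹' segment ℝ (e p) (e q)))ᶜ :=
    isPathConnected_compl_union_chartSegment (M := M) hS hqs (Ne.symm hqp) hRt hqR hdisj
  have hUq : IsPathConnected (S ∪ (e.source ∩ e ⁻¹' segment ℝ (e q) (e p)))ᶜ := by
    rw [segment_symm]; exact hU
  have h2 := ChartSegment.isPathConnected_compl_insert_insert hqs hps hqp (hball.trans hRt) hpR
    hS.isClosed hdisj' hUq
  have h1 := ChartSegment.isPathConnected_compl_insert hqs hps hqp (hball.trans hRt) hpR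
    hS.isClosed hdisj' hUq
  obtain ⟨x⟩ := h2.nonempty.to_subtype
  obtain ⟨y⟩ := h1.nonempty.to_subtype
  obtain ⟨E⟩ := ChartSegment.nonempty_mulEquiv_coprod_int hqs hps hqp (hball.trans hRt) hpR
    hS.isClosed hdisj' hUq x y
  have B : FreePi (insert q (insert p S)) ↔ FreePi (insert q S) := by
    constructor
    · intro h
      exact freePi_of_exists h1 ⟨y, (isFreeOfFiniteRank_coprod_int_iff _).1 (IsFreeOfFiniteRank.congr E (h x))⟩
    · intro h
      exact freePi_of_exists h2 ⟨x, IsFreeOfFiniteRank.congr E.symm ((isFreeOfFiniteRank_coprod_int_iff _).2 (h y))⟩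
  rw [Set.insert_comm] at B
  exact propext (B.symm.trans A)

/-- **Moving one puncture**: for `S` finite and `p, q ∉ S`, `FreePi (S ∪ {p}) ↔ FreePi (S ∪ {q})`
(local constancy on the connected `M ∖ S`). [cite: HatcherAT2002, §1.2 Example 1.22 (method)] -/
theorem freePi_insert_iff_insert {S : Set M} (hS : S.Finite) {p q : M} (hp : p ∉ S) (hq : q ∉ S) :
    FreePi (insert p S) ↔ FreePi (insert q S) := by
  -- the function `g : ↥Sᶜ → Prop`, `g y = FreePi (insert y S)` is locally constant
  let g : ↥(Sᶜ : Set M) → Prop := fun y => FreePi (insert (y : M) S)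
  have hg : IsLocallyConstant g := by
    rw [IsLocallyConstant.iff_eventually_eq]
    intro y
    have := freePi_insert_eventually_eq hS (p := (y : M)) y.2
    exact (continuous_subtype_val.continuousAt.eventually this)
  have hSc : IsPreconnected (Sᶜ : Set M) :=
    (isPathConnected_compl_finite hS ⟨p, hp⟩).isConnected.isPreconnected
  haveI : PreconnectedSpace ↥(Sᶜ : Set M) := Subtype.preconnectedSpace hSc
  have := hg.apply_eq_of_isPreconnected isPreconnected_univ (x := ⟨p, hp⟩) (y := ⟨q, hq⟩)
    (mem_univ _) (mem_univ _)
  exact Iff.of_eq this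

/-- **Adding one puncture**: for `S` finite non-empty and `q ∉ S`, `FreePi S ↔ FreePi (S ∪ {q})`.
[cite: HatcherAT2002, §1.2 Example 1.22] -/
theorem freePi_iff_insert {S : Set M} (hS : S.Finite) (hSne : S.Nonempty) {q : M} (hq : q ∉ S) :
    FreePi S ↔ FreePi (insert q S) := by
  obtain ⟨s, hs⟩ := hSne
  set S₀ := S \ {s} with hS₀
  have hS₀f : S₀.Finite := hS.subset sdiff_subset
  have hsS₀ : s ∉ S₀ := fun h => h.2 rfl
  have hSeq : S = insert s S₀ := by
    ext x; by_cases hx : x = s <;> simp [hS₀, hx, hs]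
  obtain ⟨R, hR, hRt, hdisj⟩ := exists_chartBall_disjoint hS₀f hsS₀
  obtain ⟨p, hps, hpsrc, hpR⟩ := exists_ne_mem_chartBall hR hRt
  have hpS₀ : p ∉ S₀ := fun h => hdisj.le_bot ⟨h, hpsrc, hpR⟩
  have hpS : p ∉ S := by rw [hSeq]; exact fun h => h.elim hps hpS₀
  -- `FreePi (S₀ ∪ {s, p}) ↔ FreePi (S₀ ∪ {s}) = FreePi S`
  have A := freePi_insert_insert_iff hS₀f hpsrc (Ne.symm hps) hRt hpR hdisj
  -- `FreePi (S ∪ {p}) ↔ FreePi (S ∪ {q})`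
  have B := freePi_insert_iff_insert hS hpS hq
  rw [hSeq, Set.insert_comm] at B
  rw [hSeq]
  exact (A.symm.trans B)

/-- **Adding finitely many punctures.** [cite: HatcherAT2002, §1.2 Example 1.22] -/
theorem freePi_iff_union {S : Set M} (hS : S.Finite) (hSne : S.Nonempty) {T : Set M} (hT : T.Finite) :
    FreePi S ↔ FreePi (S ∪ T) := by
  induction T, hT using Set.Finite.induction_on with
  | empty => rw [union_empty]
  | @insert q T₀ hq hT₀ ih =>
    rw [union_insert]
    by_cases hq' : q ∈ S ∪ T₀
    · rw [insert_eq_of_mem hq']; exact ih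
    · exact ih.trans (freePi_iff_insert (hS.union hT₀) (hSne.mono subset_union_left) hq')

/-- **Puncture independence**: for a connected Hausdorff surface `M` (charted over `ℂ`) and
finite non-empty `S, S' ⊆ M`, `π₁(M ∖ S)` is free of finite rank (at every base point) iff
`π₁(M ∖ S')` is. [cite: HatcherAT2002, §1.2 Example 1.22] -/
theorem freePi_iff_freePi {S S' : Set M} (hS : S.Finite) (hSne : S.Nonempty) (hS' : S'.Finite)
    (hS'ne : S'.Nonempty) : FreePi S ↔ FreePi S' :=
  (freePi_iff_union hS hSne hS').trans ((union_comm S S').symm ▸ (freePi_iff_union hS' hS'ne hS).symm)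

/-- **Puncture independence, base-point form**: if `π₁(M ∖ S', x)` is free of finite rank for ONE
finite non-empty `S'` and one base point `x`, then `π₁(M ∖ S, y)` is free of finite rank for EVERY
finite non-empty `S` and every base point `y`. [cite: HatcherAT2002, §1.2 Example 1.22] -/
theorem isFreeOfFiniteRank_fundamentalGroup_compl_of_compl {S S' : Set M} (hS : S.Finite)
    (hSne : S.Nonempty) (hS' : S'.Finite) (hS'ne : S'.Nonempty) (x : ↥(S'ᶜ : Set M))
    (hx : IsFreeOfFiniteRank (_root_.FundamentalGroup ↥(S'ᶜ : Set M) x)) (y : ↥(Sᶜ : Set M)) :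
    IsFreeOfFiniteRank (_root_.FundamentalGroup ↥(Sᶜ : Set M) y) :=
  (freePi_iff_freePi hS hSne hS' hS'ne).2
    (freePi_of_exists (isPathConnected_compl_finite hS' ⟨x, x.2⟩) ⟨x, hx⟩) y

end Independence

end PunctureIndependence

end Literature.AlgebraicTopology.FundamentalGroup

end
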